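import Literature.MathematicalPhysics.QuantumFieldTheory.Balaban1983to89.BlockAveragingFederbushB7
import Literature.Analysis.Calculus.ImplicitChart

/-!
# FEDERBUSH'S IMPLICIT AVERAGE (0.10) of [Balaban1987RG1] IS COMPLEX-ANALYTIC IN THE FAMILY — the analytic implicit
# function theorem for `Σ_j log (U_j M⁻¹) = 0`, PROVED; print's «we assume that it is an analytic function» DISCHARGED
# for print's own proposal (0.10); the hypothesis structure `IsAnalyticMean` INHABITED by it

T. Bałaban, *Renormalization group approach to lattice gauge field theories. I*, Comm. Math. Phys. **109** (1987)
249–301 (`Balaban1987RG1`, "B12"), §0 p. 253 (locus quoted in the header of the tree's `BlockAveragingFederbush`):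
the averaging operation `M` «is a `Gᶜ`-valued function defined on sets `{U_j : j = 1, 2, ..., n}`, `U_j ∈ Gᶜ`, with
sufficiently small diameters», «we assume that it is an analytic function», (0.8) «for a set `{U_j}` of elements close to the identity of
the group … the average is close to the identity also, and `(1/i) log M({exp iA_j}) = (1/n) Σ_j A_j + (higher order
terms)`», and (0.10) «The average of the set `{U_j}` is the element `U ∈ Gᶜ` such that `U_j` are in a small neighborhood
of `U`, and it satisfies the equation `Σ_{j=1}^{n} (1/i) log U_j U⁻¹ = 0`.»  The tree's `BlockAveragingFederbush`
CONSTRUCTS the solution of (0.10) (`fedSol`, on every complete normed `ℂ`-algebra, for families `W` with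
`‖W_j − 1‖ ≤ 1/100`) and the group averages `fedM`, `federbushU`, `federbushSU` on `U(N)`, `SU(N)`, and proves (0.5)–(0.9)
and a quantified (0.8); its header records (§ "What is NOT encoded") that "analyticity / `C¹` of `U ↦ M U` is NOT
proved (Lipschitz continuity is)" and that "analyticity follows from the analytic implicit function theorem; neither is
done in this file"; the tree's `BlockAveragingFederbushB7` (imported here; "the sibling" below) names the average with
base point `1`, `fedMean U = (fedSol U)⁻¹`, and proves for it the algebra (0.5)–(0.7), (0.9) and four NUMERICAL
use-forms of (0.8) with sharp constants, its header recording likewise that "ANALYTICITY / differentiability of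
`U ↦ fedMean U` is NOT proved in THIS file" and that the derivative form `IsAnalyticMean.norm_fderiv_sub_mean_le` "has
no counterpart here".  THIS FILE PROVES THEM (guillemets «…» below quote PRINT, [B12] p. 253, verbatim; double quotes
quote tree headers).  Nothing printed is asserted; every statement below
is kernel-proved; `log` = the series logarithm `MatrixLog.mlog` (21); nothing from B12's reference [35 (II)]
(unpublished) is used.

## What this file PROVES

Throughout `𝔸` is a complete normed `ℂ`-algebra, `I` a nonempty finite index type, families are `I → 𝔸` with the sup
norm, `fed W X = |I|⁻¹ Σ_j log (W_j X)` and `fedSol W` its solution (`BlockAveragingFederbush` §2, §2b),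
`fedMean U = (fedSol U)⁻¹` (`BlockAveragingFederbushB7`, algebraic inverse `Ring.inverse`).

* §A1 **THE COMPLEX-ANALYTIC IMPLICIT FUNCTION THEOREM FOR (0.10)**: `W ↦ fedSol W` is complex-analytic
  (`AnalyticAt ℂ`, maps of complex Banach spaces `(I → 𝔸) → 𝔸`) at every family with all `‖W_j − 1‖ < 1/100`
  (`analyticAt_fedSol`, `analyticOnNhd_fedSol`, `contDiffOn_fedSol`), with derivative `−∂₂⁻¹ ∘ ∂₁`
  (`hasStrictFDerivAt_fedSol`).  Ingredients: the equation `(W, X) ↦ fed W X` is JOINTLY analytic (`analyticAt_fedU`,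
  from the tree's `ExpMeanLog.analyticAt_mlog`); its partial derivative in the unknown is within `1/6` of the identity
  (`norm_fderiv_fed_sub_one_le` — the derivative of the `1/6`-Lipschitz map `fed W − id` of `BlockAveragingFederbush` §2),
  hence invertible (Neumann series); Mathlib's implicit function theorem in the `C^ω` class over `ℂ`
  (`ContDiffAt.implicitFunction`, `contDiffAt_implicitFunction`, `eventually_apply_eq_iff_implicitFunction`, file
  `Mathlib.Analysis.Calculus.ImplicitContDiff`; `ω ≠ 0` is the tree's `Literature.Analysis.Calculus.omega_ne_zero`) and
  `C^ω ⇒ analytic` (`ContDiffAt.analyticAt`); and the identification of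
  Mathlib's implicit function with `fedSol` near each point (`implicitFunction_eventuallyEq_fedSol`, from the continuity
  `continuousOn_fedSol` and `fed W (fedSol W) = 0`).
* §A2 **PRINT'S AVERAGE NEAR THE IDENTITY FAMILY, `fedMean`, IS ANALYTIC AND INHABITS
  `B7TransferAnalyticMean.IsAnalyticMean`** with `(r, K) = (1/100, 1/32)` (`isAnalyticMean_fedMean`): analytic at every
  `1/100`-small family (`analyticAt_fedMean`) / on the sup-norm polydisc `ball 1 (1/100)` (`analyticOnNhd_fedMean_ball`),
  `‖M U − 1‖ ≤ 1/32` there (the sibling's `norm_fedMean_sub_one_le`), `M 1 = 1`, and (0.8) to first order — obtained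
  from the structure's constructor `IsAnalyticMean.of_littleO`, whose little-o hypothesis `h08`
  (`isLittleO_mlog_fedMean_exp_sub_mean`) is supplied by the sibling's quantified (0.8), (U4)
  `norm_mlog_fedMean_exp_sub_mean_le` (defect `≤ 140‖A‖²` for `‖A‖ ≤ 1/200`).  Corollaries, (0.8) AS A DERIVATIVE:
  `D(fedMean)(1) = (V ↦ |I|⁻¹ Σ_j V_j)` (the field `isAnalyticMean_fedMean.hasFDerivAt_one`) and
  `D(fedSol)(1) = −(V ↦ |I|⁻¹ Σ_j V_j)` (`hasFDerivAt_fedSol_one`, `fderiv_fedSol_one`).  So every consequence the tree's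
  `B7TransferAnalyticMean` draws from the ABSTRACT axioms `IsAnalyticMean M r K` (its §3–§4: Lipschitz bound, (U4),
  (47'), derivative-level and integrated (U5)) holds for THIS `M` with `(r, K) = (1/100, 1/32)` — the structure is not
  vacuous, and is satisfied by the average print itself proposes; in particular the DERIVATIVE-level (U5)
  `IsAnalyticMean.norm_fderiv_sub_mean_le`, which the sibling records as having "no counterpart" among its direct forms,
  now holds for `fedMean` (with the generic constant).
* §A3 **`Gᶜ`-FAMILIES near an invertible base member `U_k`**: `fedMeanGc k U = fedMean (U_j U_k⁻¹)_j · U_k`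
  (ALGEBRAIC inverse `Ring.inverse`, no adjoint) is a unit (`isUnit_fedMeanGc`), solves (0.10)
  `Σ_j log (U_j M⁻¹) = 0` (`sum_mlog_mul_inverse_fedMeanGc`), and is complex-analytic in `U` (`analyticAt_fedMeanGc`) on
  the OPEN set `{U | U_k invertible, ∀ j ‖U_j U_k⁻¹ − 1‖ < 1/100}` (`isOpen_fedMeanGc_dom`, `analyticOnNhd_fedMeanGc`) —
  print's «`Gᶜ`-valued function defined on sets `{U_j : j = 1, 2, ..., n}`, `U_j ∈ Gᶜ`, with sufficiently small
  diameters», «analytic».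
* §A4 **MATRICES** (`M_N(ℂ)`, `L²`-operator norm, `G = U(N)`, `Gᶜ = GL(N, ℂ)`): for EVERY unitary family on the guard of
  `BlockAveragingFederbush` §4 (all `‖U_i U_k* − 1‖ < δ`, `δ ≤ 1/100`) the group average IS the analytic one,
  `fedM δ U = fedMeanGc 0 U` (`fedM_eq_fedMeanGc`: the solution for a unitary family is unitary, §3 there, so adjoint =
  inverse), hence `fedM δ` — and with it `federbushU.M`, `federbushSU.M` — is the restriction to unitary families of
  a map HOLOMORPHIC IN THE `(m+1)·N²` MATRIX ENTRIES (`analyticAt_fedMeanGc_of_unitary`), and it solves (0.10) with the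
  algebraic inverse (`sum_mlog_mul_inverse_fedM`).

* §A5 (v2.1, append-only) **(0.8″) AT THE DERIVATIVE LEVEL WITH DIRECT CONSTANTS** — the sibling's missing
  "counterpart": for every family with `‖U − 1‖ < 1/100` (sup norm) and every direction `W`,
  `‖D(fedMean)(U) W − |I|⁻¹ Σ_j W_j‖ ≤ 21 · ‖W‖ · ‖U − 1‖` (`norm_fderiv_fedMean_sub_mean_le`; operator form
  `‖D(fedMean)(U) − mean‖ ≤ 21 ‖U − 1‖`, `norm_fderiv_fedMean_sub_meanCLM_le`) and, in log form (census (U5)),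
  `‖D(log ∘ fedMean)(U) W − |I|⁻¹ Σ_j W_j‖ ≤ 25 · ‖W‖ · ‖U − 1‖` (`norm_fderiv_mlog_fedMean_sub_mean_le`) — versus the
  generic `32K/r² = 10⁴` resp. `64K/r² = 2·10⁴` on `‖U − 1‖ ≤ r/8 = 1/800` that `isAnalyticMean_fedMean` yields through
  `B7TransferAnalyticMean`.  Ingredients: the EXPLICIT derivative of the equation, `D(fedU)(U, X) (H, V) =
  |I|⁻¹ Σ_j T_j (U_j V + H_j X)` with `T_j = D log (U_j X) = Σ' n, LogFDeriv.term (U_j X − 1) n` the derivative series of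
  the tree's `Literature.Analysis.SpecialFunctions.LogFDeriv` (`fedUD`, `hasFDerivAt_fedU`, product rule
  `HasFDerivAt.mul'` + `LogFDeriv.hasFDerivAt_logOnePlus_sub_one`); the derivative of the mean,
  `D(fedMean)(U) H = M · ∂₂⁻¹(∂₁ H) · M` (`hasFDerivAt_fedMean`: §A1's `hasStrictFDerivAt_fedSol` composed with Mathlib's
  `hasFDerivAt_ringInverse`), and of its logarithm (`hasFDerivAt_mlog_fedMean`); and the bounds `‖T_j − 1‖ ≤ (17/4) δ`
  (`norm_logD_sub_one_le`, from `LogFDeriv.norm_tsum_term_sub_id_le` and the sibling base's `norm_mul_sub_one_le`,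
  `norm_fedSol_sub_one_le`), `‖∂₂ − 1‖ ≤ (53/10) δ` (`norm_fedUD_inr_sub_one_le`), `‖∂₁ H − mean H‖ ≤ (15/2) δ ‖H‖`
  (`norm_fedUD_inl_sub_mean_le`), `‖∂₂⁻¹ − 1‖ ≤ (28/5) δ` (the base's `isUnit_and_norm_inverse_sub_one_le` in the Banach
  algebra `𝔸 →L[ℂ] 𝔸`), `‖M − 1‖ ≤ (31/10) δ` (the sibling's `norm_fedMean_sub_one_le`), assembled by
  `M y M − m = (y − m) + (M − 1) y + y (M − 1) + (M − 1) y (M − 1)` (`deriv_const_arith`; paper value `≈ 20.8`).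

* §A6 (v2.2, append-only) **SANITY AND NON-VACUITY AT LITERAL TYPES**: for COMMUTING SCALARS (`𝔸 = ℂ`) Federbush's
  mean is the geometric mean — `(fedMean u)^{|I|} = Π_j u_j` for `|u_j − 1| ≤ 1/100` (`fedMean_pow_card_eq_prod`:
  exponentiate (0.10), `Π_j (u_j X) = exp Σ_j log (u_j X) = 1`, `X = (fedMean u)⁻¹`), `(fedMean u)² = u₀ u₁` for two scalars
  (`fedMean_sq_eq_mul`) and the concrete non-identity family `u = (201/200, 199/200)`, `(fedMean u)² = 39999/40000`
  (`fedMean_sq_example`); and the three headline statements SPECIALISED BY NAME to two blocks of `2 × 2` complex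
  matrices in the `L²`-operator norm (`isAnalyticMean_fedMean_matrixTwo`, `norm_fderiv_fedMean_sub_mean_le_matrixTwo`,
  `norm_fderiv_mlog_fedMean_sub_mean_le_matrixTwo`) — the carved row T4-D.L2-FED-DERIV°'s item (3).

## Scope and what is NOT done

The radius `1/100` and the constants `1/6`, `1/32`, `21`, `25` are the FILES' (print: «sufficiently small diameters», «higher
order terms»; `21`, `25` are not claimed sharp).  The quantitative use-forms of (0.8) for this `M` with explicit constants (Lipschitz, (47'), (U4),
integrated (U5)) are NOT re-proved here: with sharp direct constants they are the tree's `BlockAveragingFederbushB7`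
(imported; its (U4) and closeness bound are used above), and with `B7TransferAnalyticMean`'s generic constants they
also follow abstractly from `isAnalyticMean_fedMean`; §A5 adds only the DERIVATIVE-level forms (plain and log) with
direct constants, on the sup-norm ball `‖U − 1‖ < 1/100` (no second-order Taylor remainder with a direct constant is
given — the generic `IsAnalyticMean.norm_sub_sub_fderiv_le` applies).  No statement about `SU(N)`-values beyond `BlockAveragingFederbush` is made (analyticity concerns the ambient
algebra `M_N(ℂ) ⊃ GL(N, ℂ) = U(N)ᶜ`).  This is an interface discharge — the kernel NON-VACUITY of the analyticity axiom
for print's own average — not an estimate of the papers and not progress on any renormalization-group statement.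
-/

noncomputable section

open NormedSpace Metric Set

namespace Literature.MathematicalPhysics.QuantumFieldTheory.Balaban1983to89

namespace FederbushMean

open MatrixLog ExpMeanLog


/-! ## A1. The complex-analytic implicit function theorem for (0.10): `W ↦ fedSol W` is analytic -/

section Analytic

open Filter Topology Asymptotics
open scoped ContDiff
open Literature.Analysis.Calculus (omega_ne_zero)

variable {𝔸 : Type*} [NormedRing 𝔸] [NormedAlgebra ℂ 𝔸] [CompleteSpace 𝔸]
variable {ι : Type*} [Fintype ι]

/-- The left side of (0.10) as a function of the PAIR (family, unknown): `fedU (W, X) = fed W X = |I|⁻¹ Σ_j log (W_j X)` —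
the implicit equation to which the analytic implicit function theorem is applied. [folklore] -/
def fedU (p : (ι → 𝔸) × 𝔸) : 𝔸 := fed p.1 p.2

omit [CompleteSpace 𝔸] in
/-- Unfolding `fedU` on a pair. [folklore] -/
@[simp] theorem fedU_apply (W : ι → 𝔸) (X : 𝔸) : fedU (W, X) = fed W X := rfl

/-- **Joint complex analyticity of the implicit equation (0.10)**: `(W, X) ↦ |I|⁻¹ Σ_j log (W_j X)` is analytic, as a
map of complex Banach spaces `(I → 𝔸) × 𝔸 → 𝔸`, at every pair with all `‖W_j X − 1‖ < 1` (coordinate projections and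
the product of the algebra are analytic, the series logarithm is analytic on `‖· − 1‖ < 1` — the tree's
`ExpMeanLog.analyticAt_mlog` — and finite averages of analytic maps are analytic). [folklore] -/
theorem analyticAt_fedU {p : (ι → 𝔸) × 𝔸} (hp : ∀ j, ‖p.1 j * p.2 - 1‖ < 1) :
    AnalyticAt ℂ (fedU : (ι → 𝔸) × 𝔸 → 𝔸) p := by
  have h1 : ∀ j, AnalyticAt ℂ (fun q : (ι → 𝔸) × 𝔸 => q.1 j) p := fun j =>
    ((ContinuousLinearMap.proj (R := ℂ) (φ := fun _ : ι => 𝔸) j).comp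
      (ContinuousLinearMap.fst ℂ (ι → 𝔸) 𝔸)).analyticAt p
  have h2 : AnalyticAt ℂ (fun q : (ι → 𝔸) × 𝔸 => q.2) p := analyticAt_snd
  have hmul : ∀ j, AnalyticAt ℂ (fun q : (ι → 𝔸) × 𝔸 => q.1 j * q.2) p := fun j => (h1 j).mul h2
  have hterm : ∀ j, AnalyticAt ℂ (fun q : (ι → 𝔸) × 𝔸 => mlog (q.1 j * q.2)) p := fun j =>
    (ExpMeanLog.analyticAt_mlog (hp j)).fun_comp_of_eq (hmul j) rfl
  have hsum : AnalyticAt ℂ (fun q : (ι → 𝔸) × 𝔸 => ∑ j, mlog (q.1 j * q.2)) p :=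
    Finset.analyticAt_fun_sum Finset.univ fun j _ => hterm j
  have h : (fedU : (ι → 𝔸) × 𝔸 → 𝔸) = fun q => (Fintype.card ι : ℂ)⁻¹ • ∑ j, mlog (q.1 j * q.2) := rfl
  rw [h]
  exact hsum.fun_const_smul

omit [NormedAlgebra ℂ 𝔸] [CompleteSpace 𝔸] [Fintype ι] in
/-- On the domain of §2 the analyticity condition holds with room to spare: `‖W_j X − 1‖ < 1` for `‖W_j − 1‖ ≤ 1/100`,
`‖X − 1‖ ≤ 2/25`. [folklore] -/
theorem norm_mul_sub_one_lt_one {W : ι → 𝔸} (hW : ∀ j, ‖W j - 1‖ ≤ 1 / 100) {X : 𝔸} (hX : ‖X - 1‖ ≤ 2 / 25)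
    (j : ι) : ‖W j * X - 1‖ < 1 :=
  (norm_mul_sub_one_le (hW j) hX).trans_lt (by norm_num)

omit [CompleteSpace 𝔸] in
/-- The partial derivative of the implicit equation in the unknown, `∂₂ = D(fedU)(W, X) ∘ inr`, IS the derivative of the
one-variable map `fed W` at `X`. [folklore] -/
theorem hasFDerivAt_fed_of_fedU {W : ι → 𝔸} {X : 𝔸} (h : DifferentiableAt ℂ (fedU : (ι → 𝔸) × 𝔸 → 𝔸) (W, X)) :
    HasFDerivAt (fed W) (fderiv ℂ fedU (W, X) ∘L ContinuousLinearMap.inr ℂ (ι → 𝔸) 𝔸) X :=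
  h.hasFDerivAt.comp X (hasFDerivAt_prodMk_right W X)

variable [Nonempty ι]

/-- **The partial derivative in the unknown is within `1/6` of the identity**: if `fed W` has derivative `D` at a point
`X` of the open ball `‖X − 1‖ < 2/25` (`‖W_j − 1‖ ≤ 1/100`), then `‖D − 1‖ ≤ 1/6` — the derivative of the
`1/6`-Lipschitz map `fed W − id` of §2 (`norm_fed_sub_fed_sub_le`, `fed_const_le`) has norm `≤ 1/6`. [folklore] -/
theorem norm_fderiv_fed_sub_one_le {W : ι → 𝔸} (hW : ∀ j, ‖W j - 1‖ ≤ 1 / 100) {X : 𝔸} (hX : ‖X - 1‖ < 2 / 25)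
    {D : 𝔸 →L[ℂ] 𝔸} (hD : HasFDerivAt (fed W) D X) : ‖D - 1‖ ≤ 1 / 6 := by
  have hD' : HasFDerivAt (fun Y => fed W Y - Y) (D - 1) X := by
    rw [ContinuousLinearMap.one_def]; exact hD.sub (hasFDerivAt_id X)
  refine hD'.le_of_lip' (by norm_num) ?_
  have hmem : closedBall (1 : 𝔸) (2 / 25) ∈ 𝓝 X := closedBall_mem_nhds_of_mem (by rwa [mem_ball, dist_eq_norm])
  filter_upwards [hmem] with Y hY
  rw [mem_closedBall, dist_eq_norm] at hY
  have h := norm_fed_sub_fed_sub_le hW (R := 2 / 25) (by norm_num) hY hX.le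
  have hc := fed_const_le (δ := 1 / 100) (by norm_num) le_rfl
  calc ‖fed W Y - Y - (fed W X - X)‖ = ‖fed W Y - fed W X - (Y - X)‖ := by congr 1; abel
    _ ≤ _ := h.trans (mul_le_mul_of_nonneg_right hc (norm_nonneg _))

omit [Nonempty ι] in
/-- A continuous linear map within `t < 1` of the identity is invertible (Neumann series, §2's
`isUnit_and_norm_inverse_sub_one_le` in the Banach algebra `𝔸 →L[ℂ] 𝔸`). [folklore] -/
theorem isInvertible_of_norm_sub_one_le {D : 𝔸 →L[ℂ] 𝔸} {t : ℝ} (hD : ‖D - 1‖ ≤ t) (ht : t < 1) : D.IsInvertible := by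
  have hu : IsUnit D := (isUnit_and_norm_inverse_sub_one_le hD ht).1
  refine ContinuousLinearMap.IsInvertible.of_inverse (g := Ring.inverse D) ?_ ?_
  · rw [← ContinuousLinearMap.mul_def, Ring.mul_inverse_cancel _ hu, ContinuousLinearMap.one_def]
  · rw [← ContinuousLinearMap.mul_def, Ring.inverse_mul_cancel _ hu, ContinuousLinearMap.one_def]

/-- The data of the analytic implicit function theorem at a small family `W` (`‖W_j − 1‖ < 1/100`) and its solution
`X = fedSol W`: the equation is `C^ω` at `(W, X)` and its partial derivative in the unknown is invertible. [folklore] -/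
theorem contDiffAt_fedU_and_isInvertible {W : ι → 𝔸} (hW : ∀ j, ‖W j - 1‖ < 1 / 100) :
    ContDiffAt ℂ ω (fedU : (ι → 𝔸) × 𝔸 → 𝔸) (W, fedSol W) ∧
      (fderiv ℂ fedU (W, fedSol W) ∘L ContinuousLinearMap.inr ℂ (ι → 𝔸) 𝔸).IsInvertible := by
  have hW' : ∀ j, ‖W j - 1‖ ≤ 1 / 100 := fun j => (hW j).le
  have hX : ‖fedSol W - 1‖ ≤ 3 / 100 := (fedSol_spec hW').1
  have han : AnalyticAt ℂ (fedU : (ι → 𝔸) × 𝔸 → 𝔸) (W, fedSol W) :=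
    analyticAt_fedU fun j => norm_mul_sub_one_lt_one hW' (hX.trans (by norm_num)) j
  exact ⟨han.contDiffAt, isInvertible_of_norm_sub_one_le
    (norm_fderiv_fed_sub_one_le hW' (hX.trans_lt (by norm_num)) (hasFDerivAt_fed_of_fedU han.differentiableAt))
    (by norm_num)⟩

/-- **The implicit function of (0.10) IS `fedSol` near every small family.**  Mathlib's implicit function
`ψ = ContDiffAt.implicitFunction` of `fedU` at `(W₀, fedSol W₀)` is characterised near that point by
`fedU (W, Y) = fedU (W₀, fedSol W₀) (= 0) ↔ ψ W = Y` (`eventually_apply_eq_iff_implicitFunction`); since `W ↦ (W, fedSol W)`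
is continuous at `W₀` (§2b `continuousOn_fedSol` on the open set of small families) and `fed W (fedSol W) = 0`, `ψ = fedSol`
eventually. [folklore] -/
theorem implicitFunction_eventuallyEq_fedSol {W₀ : ι → 𝔸} (hW₀ : ∀ j, ‖W₀ j - 1‖ < 1 / 100) :
    (contDiffAt_fedU_and_isInvertible hW₀).1.implicitFunction omega_ne_zero (contDiffAt_fedU_and_isInvertible hW₀).2
      =ᶠ[𝓝 W₀] (fedSol : (ι → 𝔸) → 𝔸) := by
  have hW₀' : ∀ j, ‖W₀ j - 1‖ ≤ 1 / 100 := fun j => (hW₀ j).le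
  have hψ := (contDiffAt_fedU_and_isInvertible hW₀).1.eventually_apply_eq_iff_implicitFunction omega_ne_zero
    (contDiffAt_fedU_and_isInvertible hW₀).2
  have hnhds : smallFamilies ι 𝔸 (1 / 100) ∈ 𝓝 W₀ := (isOpen_smallFamilies (1 / 100)).mem_nhds hW₀
  have hcont : ContinuousAt (fun W : ι → 𝔸 => (W, fedSol W)) W₀ :=
    continuousAt_id.prodMk (continuousOn_fedSol.continuousAt hnhds)
  have h1 : ∀ᶠ W in 𝓝 W₀, fedU (W, fedSol W) = fedU (W₀, fedSol W₀) ↔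
      (contDiffAt_fedU_and_isInvertible hW₀).1.implicitFunction omega_ne_zero
        (contDiffAt_fedU_and_isInvertible hW₀).2 (W, fedSol W).1 = (W, fedSol W).2 :=
    Filter.Tendsto.eventually hcont hψ
  filter_upwards [h1, hnhds] with W h hWs
  exact h.1 (by rw [fedU_apply, fedU_apply, fed_fedSol fun j => (hWs j).le, fed_fedSol hW₀'])

/-- **ANALYTICITY OF FEDERBUSH'S IMPLICIT SOLUTION** ([Balaban1987RG1] p. 253 «we assume that it is an analytic
function», here PROVED for the solution map of the printed equation (0.10)): `W ↦ fedSol W` is complex-analytic, as a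
map `(I → 𝔸) → 𝔸` of complex Banach spaces, at every family with all `‖W_j − 1‖ < 1/100` — the complex-analytic
implicit function theorem (Mathlib's `ContDiffAt.implicitFunction` at `n = ω` over `ℂ`, `contDiffAt_implicitFunction`,
`ContDiffAt.analyticAt`) and the identification `implicitFunction_eventuallyEq_fedSol`. [folklore] -/
theorem analyticAt_fedSol {W₀ : ι → 𝔸} (hW₀ : ∀ j, ‖W₀ j - 1‖ < 1 / 100) :
    AnalyticAt ℂ (fedSol : (ι → 𝔸) → 𝔸) W₀ :=
  (((contDiffAt_fedU_and_isInvertible hW₀).1.contDiffAt_implicitFunction omega_ne_zero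
    (contDiffAt_fedU_and_isInvertible hW₀).2).analyticAt).congr (implicitFunction_eventuallyEq_fedSol hW₀)

/-- `fedSol` is analytic on a neighbourhood of every point of the OPEN set of `1/100`-small families
(`ExpMeanLog.smallFamilies`, `isOpen_smallFamilies`). [folklore] -/
theorem analyticOnNhd_fedSol : AnalyticOnNhd ℂ (fedSol : (ι → 𝔸) → 𝔸) (smallFamilies ι 𝔸 (1 / 100)) :=
  fun _ hW => analyticAt_fedSol hW

/-- … in particular on every set of `δ`-small families with `δ ≤ 1/100`. [folklore] -/
theorem analyticOnNhd_fedSol_of_le {δ : ℝ} (hδ : δ ≤ 1 / 100) :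
    AnalyticOnNhd ℂ (fedSol : (ι → 𝔸) → 𝔸) (smallFamilies ι 𝔸 δ) :=
  analyticOnNhd_fedSol.mono (smallFamilies_mono hδ)

/-- Hence complex-(Fréchet-)differentiable at every `1/100`-small family. [folklore] -/
theorem differentiableAt_fedSol {W : ι → 𝔸} (hW : ∀ j, ‖W j - 1‖ < 1 / 100) :
    DifferentiableAt ℂ (fedSol : (ι → 𝔸) → 𝔸) W :=
  (analyticAt_fedSol hW).differentiableAt

/-- Hence `C^ω` over `ℂ` on the open set of `1/100`-small families. [folklore] -/
theorem contDiffOn_fedSol : ContDiffOn ℂ ω (fedSol : (ι → 𝔸) → 𝔸) (smallFamilies ι 𝔸 (1 / 100)) :=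
  analyticOnNhd_fedSol.contDiffOn_of_completeSpace

/-- The derivative of the solution map in terms of the partial derivatives of the equation:
`D(fedSol)(W₀) = −∂₂⁻¹ ∘ ∂₁` at `(W₀, fedSol W₀)` (Mathlib's `hasStrictFDerivAt_implicitFunction`). [folklore] -/
theorem hasStrictFDerivAt_fedSol {W₀ : ι → 𝔸} (hW₀ : ∀ j, ‖W₀ j - 1‖ < 1 / 100) :
    HasStrictFDerivAt (fedSol : (ι → 𝔸) → 𝔸)
      (-(fderiv ℂ fedU (W₀, fedSol W₀) ∘L ContinuousLinearMap.inr ℂ (ι → 𝔸) 𝔸).inverse ∘L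
        (fderiv ℂ fedU (W₀, fedSol W₀) ∘L ContinuousLinearMap.inl ℂ (ι → 𝔸) 𝔸)) W₀ :=
  ((contDiffAt_fedU_and_isInvertible hW₀).1.hasStrictFDerivAt_implicitFunction omega_ne_zero
    (contDiffAt_fedU_and_isInvertible hW₀).2).congr_of_eventuallyEq (implicitFunction_eventuallyEq_fedSol hW₀)

end Analytic

/-! ## A2. Print's average near the identity family, `fedMean U = (fedSol U)⁻¹` (`BlockAveragingFederbushB7`), is
ANALYTIC and INHABITS the hypothesis structure `B7TransferAnalyticMean.IsAnalyticMean` (analytic on the polydisc, close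
to `1`, `M 1 = 1`, `DM(1) =` arithmetic mean); (0.8) as a DERIVATIVE: `D(fedMean)(1) =` mean, `D(fedSol)(1) = −`mean -/

section Mean1

open Filter Topology Asymptotics
open B7TransferAnalyticMean (meanCLM IsAnalyticMean)

variable {𝔸 : Type*} [NormedRing 𝔸] [NormedAlgebra ℂ 𝔸] [CompleteSpace 𝔸]
variable {ι : Type*} [Fintype ι] [Nonempty ι]

omit [NormedAlgebra ℂ 𝔸] [CompleteSpace 𝔸] [Nonempty ι] in
/-- The sup-norm ball of radius `r > 0` about the identity family IS the set of `r`-small families. [folklore] -/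
theorem ball_one_eq_smallFamilies {r : ℝ} (hr : 0 < r) : ball (1 : ι → 𝔸) r = smallFamilies ι 𝔸 r := by
  ext U
  rw [mem_ball, dist_eq_norm, pi_norm_lt_iff hr, mem_smallFamilies]
  simp only [Pi.sub_apply, Pi.one_apply]

/-- **ANALYTICITY OF PRINT'S AVERAGE near the identity family**: `fedMean = (fedSol ·)⁻¹` (the tree's
`BlockAveragingFederbushB7.fedMean`, [B12] (0.10) with base point `1`) is complex-analytic, as a map `(I → 𝔸) → 𝔸` of
complex Banach spaces, at every `1/100`-small family (`analyticAt_fedSol` and the analyticity of `Ring.inverse` at units).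
[cite: Balaban1987RG1, before (0.5) p.253] -/
theorem analyticAt_fedMean {U : ι → 𝔸} (hU : ∀ j, ‖U j - 1‖ < 1 / 100) :
    AnalyticAt ℂ (fedMean : (ι → 𝔸) → 𝔸) U := by
  obtain ⟨u, hu⟩ := fedSol_isUnit U
  have h1 : AnalyticAt ℂ (Ring.inverse : 𝔸 → 𝔸) (fedSol U) := by rw [← hu]; exact analyticAt_inverse u
  show AnalyticAt ℂ (fun V : ι → 𝔸 => Ring.inverse (fedSol V)) U
  exact h1.comp (analyticAt_fedSol hU)

/-- … on a neighbourhood of every point of the open set of `1/100`-small families. [folklore] -/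
theorem analyticOnNhd_fedMean :
    AnalyticOnNhd ℂ (fedMean : (ι → 𝔸) → 𝔸) (smallFamilies ι 𝔸 (1 / 100)) :=
  fun _ hU => analyticAt_fedMean hU

/-- … equivalently on the sup-norm polydisc `ball 1 (1/100)` (the domain shape of `IsAnalyticMean`). [folklore] -/
theorem analyticOnNhd_fedMean_ball :
    AnalyticOnNhd ℂ (fedMean : (ι → 𝔸) → 𝔸) (ball (1 : ι → 𝔸) (1 / 100)) := by
  rw [ball_one_eq_smallFamilies (by norm_num)]; exact analyticOnNhd_fedMean

/-- Hence complex-differentiable at every `1/100`-small family. [folklore] -/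
theorem differentiableAt_fedMean {U : ι → 𝔸} (hU : ∀ j, ‖U j - 1‖ < 1 / 100) :
    DifferentiableAt ℂ (fedMean : (ι → 𝔸) → 𝔸) U :=
  (analyticAt_fedMean hU).differentiableAt

/-- **(0.8) in print's literal form, as a LITTLE-o statement** for the average: `log M({e^{A_j}}) − |I|⁻¹ Σ_j A_j = o(A)`
at `A = 0` — from the sibling's quantified (0.8), (U4) `BlockAveragingFederbushB7.norm_mlog_fedMean_exp_sub_mean_le`
(defect `≤ 140‖A‖²` for `‖A‖ ≤ 1/200`).  This is the hypothesis `h08` of `IsAnalyticMean.of_littleO`.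
[cite: Balaban1987RG1, (0.8) p.253] -/
theorem isLittleO_mlog_fedMean_exp_sub_mean :
    (fun A : ι → 𝔸 => mlog (fedMean fun j => exp (A j)) - meanCLM ι 𝔸 A) =o[𝓝 (0 : ι → 𝔸)] (fun A => A) := by
  rw [isLittleO_iff]
  intro c hc
  have hmem : closedBall (0 : ι → 𝔸) (min (1 / 200) (c / 140)) ∈ 𝓝 (0 : ι → 𝔸) :=
    closedBall_mem_nhds _ (lt_min (by norm_num) (by positivity))
  filter_upwards [hmem] with A hA
  rw [mem_closedBall, dist_zero_right, le_min_iff] at hA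
  refine (norm_mlog_fedMean_exp_sub_mean_le hA.1).trans ?_
  have h1 : 140 * ‖A‖ ≤ c := by
    have := hA.2; rw [le_div_iff₀ (by norm_num : (0 : ℝ) < 140)] at this; linarith
  calc 140 * ‖A‖ ^ 2 = 140 * ‖A‖ * ‖A‖ := by ring
    _ ≤ c * ‖A‖ := mul_le_mul_of_nonneg_right h1 (norm_nonneg _)

/-- **PRINT'S AVERAGE (0.10) IS AN `IsAnalyticMean`** with radius `r = 1/100` and closeness constant `K = 1/32`: the
hypothesis structure of `B7TransferAnalyticMean` ([B12] p. 253 «analytic», «close to the identity», (0.8) to first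
order) is INHABITED by `fedMean`, the average print itself proposes — so every consequence drawn there from the
abstract axioms holds for this concrete `M` with `(r, K) = (1/100, 1/32)` (the closeness bound is the sibling's
`norm_fedMean_sub_one_le`: `‖M U − 1‖ ≤ 31δ/10`).  In particular (0.8) AS A DERIVATIVE for the average,
`D(fedMean)(1) = (V ↦ |I|⁻¹ Σ_j V_j)`, is the field `isAnalyticMean_fedMean.hasFDerivAt_one :
HasFDerivAt fedMean (meanCLM I 𝔸) 1` (not restated under a name of its own: the gate identifies such a restatement with
the tree's `BlockAveragingEMLAnalyticMean.hasFDerivAt_eml_one`). [cite: Balaban1987RG1, (0.5)–(0.10) p.253] -/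
theorem isAnalyticMean_fedMean : IsAnalyticMean (fedMean : (ι → 𝔸) → 𝔸) (1 / 100) (1 / 32) :=
  IsAnalyticMean.of_littleO (by norm_num) (by norm_num) (by norm_num) analyticOnNhd_fedMean_ball
    (fun U hU => by
      rw [mem_ball, dist_eq_norm] at hU
      exact (norm_fedMean_sub_one_le le_rfl hU.le).trans (by norm_num))
    isLittleO_mlog_fedMean_exp_sub_mean

/-- **(0.8) as a derivative for the SOLUTION of (0.10)**: `D(fedSol)(1) = −`(arithmetic mean) — `fedSol = (fedMean)⁻¹`
(the sibling's `ring_inverse_fedMean`), `fedMean 1 = 1` and `D(·⁻¹)(1) = −id`. [cite: Balaban1987RG1, (0.8) p.253] -/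
theorem hasFDerivAt_fedSol_one : HasFDerivAt (fedSol : (ι → 𝔸) → 𝔸) (-meanCLM ι 𝔸) 1 := by
  have hinv : HasFDerivAt (Ring.inverse : 𝔸 → 𝔸)
      (-ContinuousLinearMap.mulLeftRight ℂ 𝔸 ↑(1 : 𝔸ˣ)⁻¹ ↑(1 : 𝔸ˣ)⁻¹) (fedMean (1 : ι → 𝔸)) := by
    rw [fedMean_one]; exact hasFDerivAt_ringInverse (1 : 𝔸ˣ)
  have hcomp := hinv.comp (1 : ι → 𝔸) isAnalyticMean_fedMean.hasFDerivAt_one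
  have hD : (-ContinuousLinearMap.mulLeftRight ℂ 𝔸 ↑(1 : 𝔸ˣ)⁻¹ ↑(1 : 𝔸ˣ)⁻¹) ∘L meanCLM ι 𝔸 = -meanCLM ι 𝔸 := by
    ext V; simp
  rw [hD] at hcomp
  exact hcomp.congr_of_eventuallyEq (Eventually.of_forall fun U => (ring_inverse_fedMean U).symm)

/-- `D(fedSol)(1) = −meanCLM`. [folklore] -/
theorem fderiv_fedSol_one : fderiv ℂ (fedSol : (ι → 𝔸) → 𝔸) 1 = -meanCLM ι 𝔸 :=
  hasFDerivAt_fedSol_one.fderiv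

end Mean1

/-! ## A3. The average near an arbitrary invertible base member: `M_k U = fedMean (U_j U_k⁻¹)_j · U_k` — analytic in
the family, invertible-valued, solving (0.10); on unitary matrix families it IS §4's `fedM` -/

section MeanAt

open Filter Topology
open B7TransferAnalyticMean (meanCLM)

variable {𝔸 : Type*} [NormedRing 𝔸] [NormedAlgebra ℂ 𝔸] [CompleteSpace 𝔸]
variable {ι : Type*} [Fintype ι] [Nonempty ι]

/-- The family relative to an invertible base member `U_k`: `W_j = U_j U_k⁻¹` (algebraic inverse). [folklore] -/
def relInv (k : ι) (U : ι → 𝔸) : ι → 𝔸 := fun j => U j * Ring.inverse (U k)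

omit [NormedAlgebra ℂ 𝔸] [CompleteSpace 𝔸] [Fintype ι] [Nonempty ι] in
/-- Unfolding `relInv`. [folklore] -/
@[simp] theorem relInv_apply (k : ι) (U : ι → 𝔸) (j : ι) : relInv k U j = U j * Ring.inverse (U k) := rfl

/-- **FEDERBUSH'S AVERAGE of a family near a base member `U_k`** (print p.253 (0.10), `Gᶜ`-families «with sufficiently
small diameters»): `M_k U = fedMean (U_j U_k⁻¹)_j · U_k = (fedSol (U_j U_k⁻¹)_j)⁻¹ · U_k`, so that
`U_j M⁻¹ = (U_j U_k⁻¹) · fedSol (…)` and (0.10) holds; for `U_k = 1` it is `fedMean U`.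
[cite: Balaban1987RG1, (0.10) p.253] -/
def fedMeanGc (k : ι) (U : ι → 𝔸) : 𝔸 := fedMean (relInv k U) * U k

/-- `M_k U` is invertible with inverse `U_k⁻¹ · fedSol (U_j U_k⁻¹)_j` (for `U_k` invertible). [folklore] -/
theorem inverse_fedMeanGc {k : ι} {U : ι → 𝔸} (hk : IsUnit (U k)) :
    IsUnit (fedMeanGc k U) ∧ Ring.inverse (fedMeanGc k U) = Ring.inverse (U k) * fedSol (relInv k U) := by
  obtain ⟨u, hu⟩ := hk
  obtain ⟨v, hv⟩ := fedSol_isUnit (relInv k U)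
  have hprod : fedMeanGc k U = ↑(v⁻¹ * u) := by rw [fedMeanGc, fedMean, Units.val_mul, ← hv, Ring.inverse_unit, hu]
  refine ⟨hprod ▸ (v⁻¹ * u).isUnit, ?_⟩
  rw [hprod, Ring.inverse_unit, mul_inv_rev, inv_inv, Units.val_mul, ← hu, Ring.inverse_unit, hv]

/-- **(0.10) near the base member**: `Σ_j log (U_j M⁻¹) = 0` for `M = fedMeanGc k U`. [cite: Balaban1987RG1, (0.10) p.253] -/
theorem sum_mlog_mul_inverse_fedMeanGc {k : ι} {U : ι → 𝔸} (hk : IsUnit (U k))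
    (hU : ∀ j, ‖relInv k U j - 1‖ ≤ 1 / 100) : ∑ j, mlog (U j * Ring.inverse (fedMeanGc k U)) = 0 := by
  rw [(inverse_fedMeanGc hk).2]
  simp only [← mul_assoc]
  exact sum_mlog_mul_fedSol hU

/-- `M_k U` is `Gᶜ`-valued in the abstract sense: a unit of `𝔸`. [cite: Balaban1987RG1, before (0.5) p.253] -/
theorem isUnit_fedMeanGc {k : ι} {U : ι → 𝔸} (hk : IsUnit (U k)) : IsUnit (fedMeanGc k U) :=
  (inverse_fedMeanGc hk).1

omit [Nonempty ι] in
/-- The relative family is analytic in the family at every `U` with `U_k` invertible. [folklore] -/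
theorem analyticAt_relInv {k : ι} {U : ι → 𝔸} (hk : IsUnit (U k)) :
    AnalyticAt ℂ (relInv k : (ι → 𝔸) → ι → 𝔸) U := by
  obtain ⟨u, hu⟩ := hk
  have hproj : ∀ i, AnalyticAt ℂ (fun V : ι → 𝔸 => V i) U := fun i =>
    (ContinuousLinearMap.proj (R := ℂ) (φ := fun _ : ι => 𝔸) i).analyticAt U
  have hinv : AnalyticAt ℂ (fun V : ι → 𝔸 => Ring.inverse (V k)) U := by
    have h1 : AnalyticAt ℂ (Ring.inverse : 𝔸 → 𝔸) (U k) := by rw [← hu]; exact analyticAt_inverse u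
    exact h1.fun_comp_of_eq (hproj k) rfl
  show AnalyticAt ℂ (fun (V : ι → 𝔸) (j : ι) => V j * Ring.inverse (V k)) U
  exact AnalyticAt.pi fun j => (hproj j).mul hinv

/-- **ANALYTICITY OF FEDERBUSH'S AVERAGE IN THE FAMILY** at every family with invertible base member and
`1/100`-small relative family (an OPEN condition): `U ↦ M_k U` is complex-analytic there, as a map `(I → 𝔸) → 𝔸` —
`analyticAt_fedMean ∘ analyticAt_relInv`, times the projection `U ↦ U_k`. [cite: Balaban1987RG1, before (0.5) p.253] -/
theorem analyticAt_fedMeanGc {k : ι} {U : ι → 𝔸} (hk : IsUnit (U k)) (hU : ∀ j, ‖relInv k U j - 1‖ < 1 / 100) :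
    AnalyticAt ℂ (fedMeanGc k : (ι → 𝔸) → 𝔸) U := by
  have h1 : AnalyticAt ℂ (fun V : ι → 𝔸 => fedMean (relInv k V)) U :=
    (analyticAt_fedMean hU).fun_comp_of_eq (analyticAt_relInv hk) rfl
  have h2 : AnalyticAt ℂ (fun V : ι → 𝔸 => V k) U :=
    (ContinuousLinearMap.proj (R := ℂ) (φ := fun _ : ι => 𝔸) k).analyticAt U
  exact h1.mul h2

omit [Nonempty ι] in
/-- The set where `M_k` is analytic is OPEN: `{U | U_k invertible ∧ ∀ j, ‖U_j U_k⁻¹ − 1‖ < 1/100}`. [folklore] -/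
theorem isOpen_fedMeanGc_dom (k : ι) :
    IsOpen {U : ι → 𝔸 | IsUnit (U k) ∧ ∀ j, ‖relInv k U j - 1‖ < 1 / 100} := by
  rw [isOpen_iff_mem_nhds]
  rintro U ⟨hk, hU⟩
  have h1 : ∀ᶠ V in 𝓝 U, IsUnit (V k) :=
    (continuous_apply k).continuousAt.eventually (Units.isOpen.mem_nhds hk)
  have h2 : ∀ᶠ V in 𝓝 U, ∀ j, ‖relInv k V j - 1‖ < 1 / 100 := by
    have hc : ContinuousAt (relInv k : (ι → 𝔸) → ι → 𝔸) U := (analyticAt_relInv hk).continuousAt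
    have := hc.eventually ((isOpen_smallFamilies (ι := ι) (𝔸 := 𝔸) (1 / 100)).mem_nhds hU)
    exact this
  filter_upwards [h1, h2] with V hV1 hV2 using ⟨hV1, hV2⟩

/-- `M_k` is analytic on a neighbourhood of every point of that open set. [folklore] -/
theorem analyticOnNhd_fedMeanGc (k : ι) :
    AnalyticOnNhd ℂ (fedMeanGc k : (ι → 𝔸) → 𝔸) {U | IsUnit (U k) ∧ ∀ j, ‖relInv k U j - 1‖ < 1 / 100} :=
  fun _ hU => analyticAt_fedMeanGc hU.1 hU.2

end MeanAt

/-! ## A4. Unitary matrix families: §4's group average `fedM` is the restriction of the analytic `fedMeanGc 0` -/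

section MatrixMean

open scoped Matrix.Norms.L2Operator

variable {n : Type*} [Fintype n] [DecidableEq n]
variable {m : ℕ}

/-- For a unitary matrix the algebraic inverse is the adjoint. [folklore] -/
theorem inverse_eq_star_of_mem_unitaryGroup {V : Matrix n n ℂ} (hV : V ∈ Matrix.unitaryGroup n ℂ) :
    Ring.inverse V = star V := by
  let u : (Matrix n n ℂ)ˣ := ⟨V, star V, Unitary.mul_star_self_of_mem hV, Unitary.star_mul_self_of_mem hV⟩
  have h : V = (u : Matrix n n ℂ) := rfl
  rw [h, Ring.inverse_unit]; rfl

/-- On a family with unitary base member `U₀`, §4's relative family `rel U 0 = (U_j U₀*)_j` is `relInv 0 U = (U_j U₀⁻¹)_j`.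
[folklore] -/
theorem relInv_zero_eq_rel {U : Fin (m + 1) → Matrix n n ℂ} (hU0 : U 0 ∈ Matrix.unitaryGroup n ℂ) :
    relInv 0 U = rel U 0 := by
  funext j; rw [relInv_apply, rel_apply, inverse_eq_star_of_mem_unitaryGroup hU0]

/-- **§4's GROUP AVERAGE IS THE RESTRICTION OF THE ANALYTIC AVERAGE**: for a unitary family on the guard (`δ ≤ 1/100`),
`fedM δ U = fedMeanGc 0 U` (the solution of (0.10) for a unitary family is unitary, §3 `fedSol_mem_unitaryGroup`, so its
adjoint is its inverse). [folklore] -/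
theorem fedM_eq_fedMeanGc {δ : ℝ} {U : Fin (m + 1) → Matrix n n ℂ} (hU : ∀ j, U j ∈ Matrix.unitaryGroup n ℂ)
    (hδ : δ ≤ 1 / 100) (h : ∀ i k, ‖U i * star (U k) - 1‖ < δ) : fedM δ U = fedMeanGc 0 U := by
  rw [fedM_of_small h, fedMeanGc, fedMean, relInv_zero_eq_rel (hU 0),
    inverse_eq_star_of_mem_unitaryGroup (fedSol_mem_unitaryGroup (rel_mem_unitaryGroup hU 0) (rel_small h hδ 0))]

/-- **ANALYTICITY OF THE GROUP AVERAGE IN THE MATRIX ENTRIES** ([Balaban1987RG1] p. 253: `M` «is a `Gᶜ`-valued function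
defined on sets `{U_j : j = 1, 2, ..., n}`, `U_j ∈ Gᶜ`, with sufficiently small diameters», «we assume that it is an
analytic function»;
`G = U(N)`, `Gᶜ = GL(N, ℂ) ⊂ M_N(ℂ)`): at every unitary family on the guard (`δ ≤ 1/100`) the map `fedMeanGc 0` — which
coincides with the group average `fedM δ` on all such families (`fedM_eq_fedMeanGc`) — is complex-analytic as a map
`(M_N(ℂ))^{m+1} → M_N(ℂ)`, and it is analytic and invertible-valued on the open set of all `GL(N, ℂ)`-based families with
`1/100`-small relative family (`analyticOnNhd_fedMeanGc`; invertible-valued, `isUnit_fedMeanGc`).  (`fedM δ` itself, whose guard and base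
change use the adjoint, is only the real-analytic restriction; the statement is about its holomorphic extension.)
[cite: Balaban1987RG1, before (0.5) p.253] -/
theorem analyticAt_fedMeanGc_of_unitary {δ : ℝ} {U : Fin (m + 1) → Matrix n n ℂ}
    (hU : ∀ j, U j ∈ Matrix.unitaryGroup n ℂ) (hδ : δ ≤ 1 / 100) (h : ∀ i k, ‖U i * star (U k) - 1‖ < δ) :
    AnalyticAt ℂ (fedMeanGc 0 : (Fin (m + 1) → Matrix n n ℂ) → Matrix n n ℂ) U := by
  have hk : IsUnit (U 0) :=
    ⟨⟨U 0, star (U 0), Unitary.mul_star_self_of_mem (hU 0), Unitary.star_mul_self_of_mem (hU 0)⟩, rfl⟩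
  refine analyticAt_fedMeanGc hk fun j => ?_
  rw [relInv_zero_eq_rel (hU 0), rel_apply]
  exact (h j 0).trans_le hδ

/-- The group average of a unitary family on the guard, read through `fedMeanGc 0`, solves print's (0.10) with the
ALGEBRAIC inverse: `Σ_j log (U_j M⁻¹) = 0`. [cite: Balaban1987RG1, (0.10) p.253] -/
theorem sum_mlog_mul_inverse_fedM {δ : ℝ} {U : Fin (m + 1) → Matrix n n ℂ} (hU : ∀ j, U j ∈ Matrix.unitaryGroup n ℂ)
    (hδ : δ ≤ 1 / 100) (h : ∀ i k, ‖U i * star (U k) - 1‖ < δ) : ∑ j, mlog (U j * Ring.inverse (fedM δ U)) = 0 := by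
  have hk : IsUnit (U 0) :=
    ⟨⟨U 0, star (U 0), Unitary.mul_star_self_of_mem (hU 0), Unitary.star_mul_self_of_mem (hU 0)⟩, rfl⟩
  rw [fedM_eq_fedMeanGc hU hδ h]
  refine sum_mlog_mul_inverse_fedMeanGc hk fun j => ?_
  rw [relInv_zero_eq_rel (hU 0)]
  exact rel_small h hδ 0 j

end MatrixMean

/-! ## A5. (0.8″) at the derivative level with DIRECT constants (v2.1, append-only): the explicit derivative of the
equation (0.10), `D(fedMean)(U) H = M · ∂₂⁻¹(∂₁ H) · M`, and `‖D(fedMean)(U) W − |I|⁻¹ Σ_j W_j‖ ≤ 21 ‖W‖ ‖U − 1‖`,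
`‖D(log ∘ fedMean)(U) W − |I|⁻¹ Σ_j W_j‖ ≤ 25 ‖W‖ ‖U − 1‖` on `‖U − 1‖ < 1/100` -/

section Deriv

open scoped RightActions
open Literature.Analysis.SpecialFunctions

open Filter Topology
open B7TransferAnalyticMean (meanCLM)

variable {𝔸 : Type*} [NormedRing 𝔸] [NormedAlgebra ℂ 𝔸] [CompleteSpace 𝔸]
variable {ι : Type*} [Fintype ι]

/-- The linear part in `(H, V)` of the derivative of `(W, X) ↦ W_j X` at `(U, X)`: `(H, V) ↦ U_j V + H_j X`. [folklore] -/
def mulD (U : ι → 𝔸) (X : 𝔸) (j : ι) : ((ι → 𝔸) × 𝔸) →L[ℂ] 𝔸 :=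
  U j • ContinuousLinearMap.snd ℂ (ι → 𝔸) 𝔸 +
    ((ContinuousLinearMap.proj (R := ℂ) (φ := fun _ : ι => 𝔸) j) ∘L ContinuousLinearMap.fst ℂ (ι → 𝔸) 𝔸) <• X

omit [CompleteSpace 𝔸] [Fintype ι] in
/-- Unfolding `mulD`. [folklore] -/
@[simp] theorem mulD_apply (U : ι → 𝔸) (X : 𝔸) (j : ι) (p : (ι → 𝔸) × 𝔸) :
    mulD U X j p = U j * p.2 + p.1 j * X := by
  simp [mulD]

omit [CompleteSpace 𝔸] in
/-- Product rule for the coordinate product `(W, X) ↦ W_j X` (Mathlib's noncommutative `HasFDerivAt.mul'`). [folklore] -/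
theorem hasFDerivAt_mul_coord (U : ι → 𝔸) (X : 𝔸) (j : ι) :
    HasFDerivAt (fun p : (ι → 𝔸) × 𝔸 => p.1 j * p.2) (mulD U X j) (U, X) := by
  have ha : HasFDerivAt (fun p : (ι → 𝔸) × 𝔸 => p.1 j)
      ((ContinuousLinearMap.proj (R := ℂ) (φ := fun _ : ι => 𝔸) j) ∘L ContinuousLinearMap.fst ℂ (ι → 𝔸) 𝔸)
      (U, X) := by
    have h := (hasFDerivAt_apply (𝕜 := ℂ) j U).comp (U, X) (hasFDerivAt_fst (𝕜 := ℂ) (E := ι → 𝔸) (F := 𝔸))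
    exact h
  have hb : HasFDerivAt (fun p : (ι → 𝔸) × 𝔸 => p.2) (ContinuousLinearMap.snd ℂ (ι → 𝔸) 𝔸) (U, X) :=
    hasFDerivAt_snd
  exact ha.mul' hb

/-- **The explicit derivative of `fedU`** at `(U, X)` (`‖U_j X − 1‖ < 1`): `(H, V) ↦ |I|⁻¹ Σ_j T_j (U_j V + H_j X)` with
`T_j = D log (U_j X) = Σ' n, LogFDeriv.term (U_j X − 1) n` the derivative series of the logarithm. [folklore] -/
def fedUD (U : ι → 𝔸) (X : 𝔸) : ((ι → 𝔸) × 𝔸) →L[ℂ] 𝔸 :=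
  (Fintype.card ι : ℂ)⁻¹ • ∑ j, (∑' n, LogFDeriv.term (U j * X - 1) n) ∘L mulD U X j

omit [CompleteSpace 𝔸] in
/-- Unfolding `fedUD`. [folklore] -/
theorem fedUD_apply (U : ι → 𝔸) (X : 𝔸) (p : (ι → 𝔸) × 𝔸) :
    fedUD U X p = (Fintype.card ι : ℂ)⁻¹ • ∑ j, (∑' n, LogFDeriv.term (U j * X - 1) n) (U j * p.2 + p.1 j * X) := by
  simp [fedUD]

/-- `fedU` has derivative `fedUD U X` at `(U, X)` whenever every `‖U_j X − 1‖ < 1` (chain rule with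
`LogFDeriv.hasFDerivAt_logOnePlus_sub_one` and the product rule). [folklore] -/
theorem hasFDerivAt_fedU {U : ι → 𝔸} {X : 𝔸} (h : ∀ j, ‖U j * X - 1‖ < 1) :
    HasFDerivAt (fedU : (ι → 𝔸) × 𝔸 → 𝔸) (fedUD U X) (U, X) := by
  have hj : ∀ j ∈ Finset.univ, HasFDerivAt (fun p : (ι → 𝔸) × 𝔸 => mlog (p.1 j * p.2))
      ((∑' n, LogFDeriv.term (U j * X - 1) n) ∘L mulD U X j) (U, X) := by
    intro j _
    have hlog := (LogFDeriv.hasFDerivAt_logOnePlus_sub_one (h j)).comp (U, X) (hasFDerivAt_mul_coord U X j)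
    exact hlog
  have hsum := (HasFDerivAt.fun_sum hj).const_smul ((Fintype.card ι : ℂ)⁻¹)
  have hfun : (fedU : (ι → 𝔸) × 𝔸 → 𝔸) =
      (Fintype.card ι : ℂ)⁻¹ • fun p : (ι → 𝔸) × 𝔸 => ∑ j ∈ Finset.univ, mlog (p.1 j * p.2) := by
    funext p; simp [fedU, fed_def]
  have hD : fedUD U X = (Fintype.card ι : ℂ)⁻¹ •
      ∑ j ∈ Finset.univ, (∑' n, LogFDeriv.term (U j * X - 1) n) ∘L mulD U X j := rfl
  rw [hfun, hD]
  exact hsum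

omit [CompleteSpace 𝔸] in
/-- The partial derivative in the unknown: `∂₂ V = |I|⁻¹ Σ_j T_j (U_j V)`. [folklore] -/
theorem fedUD_inr_apply (U : ι → 𝔸) (X V : 𝔸) :
    (fedUD U X ∘L ContinuousLinearMap.inr ℂ (ι → 𝔸) 𝔸) V =
      (Fintype.card ι : ℂ)⁻¹ • ∑ j, (∑' n, LogFDeriv.term (U j * X - 1) n) (U j * V) := by
  simp [fedUD_apply]

omit [CompleteSpace 𝔸] in
/-- The partial derivative in the family: `∂₁ H = |I|⁻¹ Σ_j T_j (H_j X)`. [folklore] -/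
theorem fedUD_inl_apply (U : ι → 𝔸) (X : 𝔸) (H : ι → 𝔸) :
    (fedUD U X ∘L ContinuousLinearMap.inl ℂ (ι → 𝔸) 𝔸) H =
      (Fintype.card ι : ℂ)⁻¹ • ∑ j, (∑' n, LogFDeriv.term (U j * X - 1) n) (H j * X) := by
  simp [fedUD_apply]

/-! ### Quantitative bounds at `X = fedSol U` -/

/-- `‖D log (u X) − 1‖ ≤ (17/4) δ` for `‖u − 1‖ ≤ δ ≤ 1/100`, `‖X − 1‖ ≤ 3δ`
(`‖u X − 1‖ ≤ 4.03 δ` and `LogFDeriv.norm_tsum_term_sub_id_le`). [folklore] -/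
theorem norm_logD_sub_one_le {δ : ℝ} (hδ : δ ≤ 1 / 100) {u X : 𝔸} (hu : ‖u - 1‖ ≤ δ) (hX : ‖X - 1‖ ≤ 3 * δ) :
    ‖(∑' n, LogFDeriv.term (u * X - 1) n) - 1‖ ≤ 17 / 4 * δ := by
  have hδ0 : 0 ≤ δ := (norm_nonneg _).trans hu
  have hε : ‖u * X - 1‖ ≤ δ * (3 * δ) + δ + 3 * δ := norm_mul_sub_one_le hu hX
  have hε' : ‖u * X - 1‖ ≤ 403 / 100 * δ := by nlinarith
  have hε1 : ‖u * X - 1‖ < 1 := by linarith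
  have h1 := LogFDeriv.norm_tsum_term_sub_id_le hε1
  rw [← ContinuousLinearMap.one_def] at h1
  refine h1.trans ?_
  rw [div_le_iff₀ (by linarith)]
  nlinarith [norm_nonneg (u * X - 1)]

variable [Nonempty ι]

omit [CompleteSpace 𝔸] in
/-- Average minus a constant = average of the differences. [folklore] -/
theorem avg_sub_const (a : ι → 𝔸) (b : 𝔸) :
    (Fintype.card ι : ℂ)⁻¹ • ∑ j, a j - b = (Fintype.card ι : ℂ)⁻¹ • ∑ j, (a j - b) := by
  have hc : (Fintype.card ι : ℂ) ≠ 0 := Nat.cast_ne_zero.mpr Fintype.card_ne_zero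
  rw [Finset.sum_sub_distrib, smul_sub, Finset.sum_const, Finset.card_univ, ← Nat.cast_smul_eq_nsmul ℂ,
    smul_smul, inv_mul_cancel₀ hc, one_smul]

/-- **`‖∂₂ − 1‖ ≤ (53/10) δ`**: the partial derivative of `fedU` in the unknown at `(U, X)`,
`‖U_j − 1‖ ≤ δ ≤ 1/100`, `‖X − 1‖ ≤ 3δ`, is within `5.3 δ` of the identity. [folklore] -/
theorem norm_fedUD_inr_sub_one_le {δ : ℝ} (hδ : δ ≤ 1 / 100) {U : ι → 𝔸} (hU : ∀ j, ‖U j - 1‖ ≤ δ) {X : 𝔸}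
    (hX : ‖X - 1‖ ≤ 3 * δ) :
    ‖fedUD U X ∘L ContinuousLinearMap.inr ℂ (ι → 𝔸) 𝔸 - 1‖ ≤ 53 / 10 * δ := by
  have hδ0 : 0 ≤ δ := (norm_nonneg _).trans (hU (Classical.arbitrary ι))
  refine ContinuousLinearMap.opNorm_le_bound _ (by positivity) fun V => ?_
  rw [sub_apply, fedUD_inr_apply, one_apply_eq_self, avg_sub_const]
  refine norm_avg_le fun j => ?_
  have hT := norm_logD_sub_one_le hδ (hU j) hX
  have hsplit : (∑' n, LogFDeriv.term (U j * X - 1) n) (U j * V) - V =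
      ((∑' n, LogFDeriv.term (U j * X - 1) n) - 1) (U j * V) + (U j - 1) * V := by
    rw [sub_apply, one_apply_eq_self]; noncomm_ring
  have hUV : ‖U j * V‖ ≤ ‖V‖ + δ * ‖V‖ := by
    have : U j * V = V + (U j - 1) * V := by noncomm_ring
    rw [this]
    exact (norm_add_le _ _).trans (add_le_add le_rfl ((norm_mul_le _ _).trans
      (mul_le_mul_of_nonneg_right (hU j) (norm_nonneg _))))
  rw [hsplit]
  calc ‖((∑' n, LogFDeriv.term (U j * X - 1) n) - 1) (U j * V) + (U j - 1) * V‖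
      ≤ ‖(∑' n, LogFDeriv.term (U j * X - 1) n) - 1‖ * ‖U j * V‖ + ‖U j - 1‖ * ‖V‖ :=
        (norm_add_le _ _).trans (add_le_add (ContinuousLinearMap.le_opNorm _ _) (norm_mul_le _ _))
    _ ≤ 17 / 4 * δ * (‖V‖ + δ * ‖V‖) + δ * ‖V‖ :=
        add_le_add (mul_le_mul hT hUV (norm_nonneg _) (by positivity))
          (mul_le_mul_of_nonneg_right (hU j) (norm_nonneg _))
    _ ≤ 53 / 10 * δ * ‖V‖ := by
        have h' := mul_nonneg (mul_nonneg hδ0 (norm_nonneg V)) (sub_nonneg.mpr hδ)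
        nlinarith [h', mul_nonneg hδ0 (norm_nonneg V)]

/-- **`‖∂₁ H − mean H‖ ≤ (15/2) δ ‖H‖`**: the partial derivative of `fedU` in the family at `(U, X)` is within
`7.5 δ` of the arithmetic mean. [folklore] -/
theorem norm_fedUD_inl_sub_mean_le {δ : ℝ} (hδ : δ ≤ 1 / 100) {U : ι → 𝔸} (hU : ∀ j, ‖U j - 1‖ ≤ δ) {X : 𝔸}
    (hX : ‖X - 1‖ ≤ 3 * δ) (H : ι → 𝔸) :
    ‖(fedUD U X ∘L ContinuousLinearMap.inl ℂ (ι → 𝔸) 𝔸) H - meanCLM ι 𝔸 H‖ ≤ 15 / 2 * δ * ‖H‖ := by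
  have hδ0 : 0 ≤ δ := (norm_nonneg _).trans (hU (Classical.arbitrary ι))
  rw [fedUD_inl_apply, B7TransferAnalyticMean.meanCLM_apply, ← smul_sub, ← Finset.sum_sub_distrib]
  refine norm_avg_le fun j => ?_
  have hT := norm_logD_sub_one_le hδ (hU j) hX
  have hsplit : (∑' n, LogFDeriv.term (U j * X - 1) n) (H j * X) - H j =
      ((∑' n, LogFDeriv.term (U j * X - 1) n) - 1) (H j * X) + H j * (X - 1) := by
    rw [sub_apply, one_apply_eq_self]; noncomm_ring
  have hHj : ‖H j‖ ≤ ‖H‖ := norm_le_pi_norm H j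
  have hHX : ‖H j * X‖ ≤ ‖H‖ + ‖H‖ * (3 * δ) := by
    have : H j * X = H j + H j * (X - 1) := by noncomm_ring
    rw [this]
    refine (norm_add_le _ _).trans (add_le_add hHj ((norm_mul_le _ _).trans ?_))
    exact mul_le_mul hHj hX (norm_nonneg _) (norm_nonneg _)
  rw [hsplit]
  calc ‖((∑' n, LogFDeriv.term (U j * X - 1) n) - 1) (H j * X) + H j * (X - 1)‖
      ≤ ‖(∑' n, LogFDeriv.term (U j * X - 1) n) - 1‖ * ‖H j * X‖ + ‖H j‖ * ‖X - 1‖ :=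
        (norm_add_le _ _).trans (add_le_add (ContinuousLinearMap.le_opNorm _ _) (norm_mul_le _ _))
    _ ≤ 17 / 4 * δ * (‖H‖ + ‖H‖ * (3 * δ)) + ‖H‖ * (3 * δ) :=
        add_le_add (mul_le_mul hT hHX (norm_nonneg _) (by positivity))
          (mul_le_mul hHj hX (norm_nonneg _) (norm_nonneg _))
    _ ≤ 15 / 2 * δ * ‖H‖ := by
        have h' := mul_nonneg (mul_nonneg hδ0 (norm_nonneg H)) (sub_nonneg.mpr hδ)
        nlinarith [h', mul_nonneg hδ0 (norm_nonneg H)]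

/-- At `X = fedSol U` (`‖U_j − 1‖ < 1/100`) every `‖U_j X − 1‖ < 1` (indeed `≤ 0.0403`), so `fedUD U (fedSol U)` is
the derivative of the equation there. [folklore] -/
theorem norm_mul_fedSol_sub_one_lt {U : ι → 𝔸} (hU : ∀ j, ‖U j - 1‖ < 1 / 100) (j : ι) :
    ‖U j * fedSol U - 1‖ < 1 := by
  have hX : ‖fedSol U - 1‖ ≤ 3 * (1 / 100) := norm_fedSol_sub_one_le le_rfl fun j => (hU j).le
  have h := norm_mul_sub_one_le (hU j).le hX
  linarith

/-- `fderiv ℂ fedU (U, fedSol U) = fedUD U (fedSol U)` — the derivative appearing in §A1's `hasStrictFDerivAt_fedSol`,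
made explicit. [folklore] -/
theorem fderiv_fedU_fedSol {U : ι → 𝔸} (hU : ∀ j, ‖U j - 1‖ < 1 / 100) :
    fderiv ℂ fedU (U, fedSol U) = fedUD U (fedSol U) :=
  (hasFDerivAt_fedU (norm_mul_fedSol_sub_one_lt hU)).fderiv

/-- **The derivative of Federbush's mean** at a `1/100`-small family: `D fedMean(U) H = M · ∂₂⁻¹(∂₁ H) · M`,
`M = fedMean U`, `∂₁, ∂₂` the partial derivatives `fedUD U (fedSol U) ∘ inl / inr` of the equation (0.10)
(`hasStrictFDerivAt_fedSol` composed with the derivative `V ↦ −M V M` of `Ring.inverse` at `fedSol U`). [folklore] -/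
theorem hasFDerivAt_fedMean {U : ι → 𝔸} (hU : ∀ j, ‖U j - 1‖ < 1 / 100) :
    HasFDerivAt (fedMean : (ι → 𝔸) → 𝔸)
      (ContinuousLinearMap.mulLeftRight ℂ 𝔸 (fedMean U) (fedMean U) ∘L
        ((fedUD U (fedSol U) ∘L ContinuousLinearMap.inr ℂ (ι → 𝔸) 𝔸).inverse ∘L
          (fedUD U (fedSol U) ∘L ContinuousLinearMap.inl ℂ (ι → 𝔸) 𝔸))) U := by
  have h1 := (hasStrictFDerivAt_fedSol hU).hasFDerivAt
  rw [fderiv_fedU_fedSol hU] at h1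
  obtain ⟨u, hu⟩ := fedSol_isUnit U
  have h2 : HasFDerivAt (Ring.inverse : 𝔸 → 𝔸)
      (-ContinuousLinearMap.mulLeftRight ℂ 𝔸 (fedMean U) (fedMean U)) (fedSol U) := by
    have := hasFDerivAt_ringInverse (𝕜 := ℂ) u
    rw [← Ring.inverse_unit u, hu] at this
    exact this
  have h3 := h2.comp U h1
  have hfun : (Ring.inverse : 𝔸 → 𝔸) ∘ (fedSol : (ι → 𝔸) → 𝔸) = fedMean := funext fun _ => rfl
  rw [hfun, ContinuousLinearMap.neg_comp, ContinuousLinearMap.comp_neg, neg_neg] at h3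
  exact h3

/-- Final arithmetic of the `(0.8″)` constant. [folklore] -/
theorem deriv_const_arith {δ h g y c : ℝ} (hδ0 : 0 ≤ δ) (hδ : δ ≤ 1 / 100) (hh : 0 ≤ h)
    (hg0 : 0 ≤ g) (hg : g ≤ 68 / 5 * δ * h) (hy0 : 0 ≤ y) (hy : y ≤ h + g) (hc0 : 0 ≤ c) (hc : c ≤ 31 / 10 * δ) :
    g + c * y + y * c + c * y * c ≤ 21 * h * δ := by
  have hc1 : c ≤ 31 / 1000 := by linarith
  have hy1 : y ≤ 1136 / 1000 * h := by nlinarith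
  have h2 : c * y ≤ 31 / 10 * δ * (1136 / 1000 * h) := mul_le_mul hc hy1 hy0 (by positivity)
  have h3 : c * y * c ≤ 31 / 10 * δ * (1136 / 1000 * h) * (31 / 1000) :=
    mul_le_mul h2 hc1 hc0 (by positivity)
  nlinarith

/-- **(0.8″), derivative form, with a DIRECT constant for Federbush's mean**: for `‖U − 1‖ < 1/100`,
`‖D fedMean(U) W − |I|⁻¹ Σ_j W_j‖ ≤ 21 · max_j ‖W_j‖ · max_j ‖U_j − 1‖` (compare the generic
`isAnalyticMean_fedMean.norm_fderiv_sub_mean_le`: `32K/r² = 10⁴` on `‖U − 1‖ ≤ 1/800`).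
[cite: Balaban1987RG1, (0.8) p.253] -/
theorem norm_fderiv_fedMean_sub_mean_le {U : ι → 𝔸} (hU : ‖U - 1‖ < 1 / 100) (W : ι → 𝔸) :
    ‖fderiv ℂ fedMean U W - meanCLM ι 𝔸 W‖ ≤ 21 * ‖W‖ * ‖U - 1‖ := by
  set δ := ‖U - 1‖ with hδdef
  have hδ0 : 0 ≤ δ := norm_nonneg _
  have hUj : ∀ j, ‖U j - 1‖ ≤ δ := fun j => by rw [hδdef]; exact norm_le_pi_norm (U - 1) j
  have hUj' : ∀ j, ‖U j - 1‖ < 1 / 100 := fun j => (hUj j).trans_lt hU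
  rw [(hasFDerivAt_fedMean hUj').fderiv]
  set X := fedSol U with hXdef
  set M := fedMean U with hMdef
  set D₂ := fedUD U X ∘L ContinuousLinearMap.inr ℂ (ι → 𝔸) 𝔸 with hD₂
  set A := (fedUD U X ∘L ContinuousLinearMap.inl ℂ (ι → 𝔸) 𝔸) W with hA
  have hX : ‖X - 1‖ ≤ 3 * δ := norm_fedSol_sub_one_le hU.le hUj
  have hM : ‖M - 1‖ ≤ 31 / 10 * δ := norm_fedMean_sub_one_le hU.le le_rfl
  have hD2 : ‖D₂ - 1‖ ≤ 53 / 10 * δ := norm_fedUD_inr_sub_one_le hU.le hUj hX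
  obtain ⟨-, hB⟩ := isUnit_and_norm_inverse_sub_one_le hD2 (by linarith)
  have hB' : ‖Ring.inverse D₂ - 1‖ ≤ 28 / 5 * δ := by
    refine hB.trans ?_
    rw [div_le_iff₀ (by linarith)]
    nlinarith
  have hAm : ‖A - meanCLM ι 𝔸 W‖ ≤ 15 / 2 * δ * ‖W‖ := norm_fedUD_inl_sub_mean_le hU.le hUj hX W
  have hm0 : ‖meanCLM ι 𝔸 W‖ ≤ ‖W‖ := B7TransferAnalyticMean.norm_meanCLM_apply_le W
  have hAn : ‖A‖ ≤ ‖W‖ + 15 / 2 * δ * ‖W‖ := by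
    have : A = meanCLM ι 𝔸 W + (A - meanCLM ι 𝔸 W) := by abel
    rw [this]; exact (norm_add_le _ _).trans (add_le_add hm0 hAm)
  have hinv : D₂.inverse = Ring.inverse D₂ := (congrFun ContinuousLinearMap.ringInverse_eq_inverse D₂).symm
  set y := Ring.inverse D₂ A with hy
  have happ : (ContinuousLinearMap.mulLeftRight ℂ 𝔸 M M ∘L (D₂.inverse ∘L
      (fedUD U X ∘L ContinuousLinearMap.inl ℂ (ι → 𝔸) 𝔸))) W = M * y * M := by
    rw [hy, hA, hinv, ContinuousLinearMap.comp_apply, ContinuousLinearMap.comp_apply,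
      ContinuousLinearMap.mulLeftRight_apply]
  rw [happ]
  -- `y − mean W = (B − 1) A + (A − mean W)`
  have hg : ‖y - meanCLM ι 𝔸 W‖ ≤ 68 / 5 * δ * ‖W‖ := by
    have : y - meanCLM ι 𝔸 W = (Ring.inverse D₂ - 1) A + (A - meanCLM ι 𝔸 W) := by
      rw [sub_apply, one_apply_eq_self]; abel
    rw [this]
    calc ‖(Ring.inverse D₂ - 1) A + (A - meanCLM ι 𝔸 W)‖
        ≤ ‖Ring.inverse D₂ - 1‖ * ‖A‖ + ‖A - meanCLM ι 𝔸 W‖ :=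
          (norm_add_le _ _).trans (add_le_add (ContinuousLinearMap.le_opNorm _ _) le_rfl)
      _ ≤ 28 / 5 * δ * (‖W‖ + 15 / 2 * δ * ‖W‖) + 15 / 2 * δ * ‖W‖ :=
          add_le_add (mul_le_mul hB' hAn (norm_nonneg _) (by positivity)) hAm
      _ ≤ 68 / 5 * δ * ‖W‖ := by
          have h' := mul_nonneg (mul_nonneg hδ0 (norm_nonneg W)) (sub_nonneg.mpr hU.le)
          nlinarith [h', mul_nonneg hδ0 (norm_nonneg W)]
  have hyn : ‖y‖ ≤ ‖W‖ + ‖y - meanCLM ι 𝔸 W‖ := by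
    have : y = meanCLM ι 𝔸 W + (y - meanCLM ι 𝔸 W) := by abel
    rw [this, add_sub_cancel_left]; exact (norm_add_le _ _).trans (add_le_add hm0 le_rfl)
  have hkey : M * y * M - meanCLM ι 𝔸 W =
      (y - meanCLM ι 𝔸 W) + (M - 1) * y + y * (M - 1) + (M - 1) * y * (M - 1) := by noncomm_ring
  rw [hkey]
  calc ‖(y - meanCLM ι 𝔸 W) + (M - 1) * y + y * (M - 1) + (M - 1) * y * (M - 1)‖
      ≤ ‖y - meanCLM ι 𝔸 W‖ + ‖M - 1‖ * ‖y‖ + ‖y‖ * ‖M - 1‖ + ‖M - 1‖ * ‖y‖ * ‖M - 1‖ := by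
        refine (norm_add_le _ _).trans (add_le_add ((norm_add_le _ _).trans (add_le_add
          ((norm_add_le _ _).trans (add_le_add le_rfl (norm_mul_le _ _))) (norm_mul_le _ _))) ?_)
        exact (norm_mul_le _ _).trans (mul_le_mul_of_nonneg_right (norm_mul_le _ _) (norm_nonneg _))
    _ ≤ 21 * ‖W‖ * δ :=
        deriv_const_arith hδ0 hU.le (norm_nonneg W) (norm_nonneg _) hg (norm_nonneg _) hyn (norm_nonneg _) hM

/-- **(0.8″) as an operator-norm bound**: `‖D fedMean(U) − mean‖ ≤ 21 · max_j ‖U_j − 1‖` for `‖U − 1‖ < 1/100`. [folklore] -/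
theorem norm_fderiv_fedMean_sub_meanCLM_le {U : ι → 𝔸} (hU : ‖U - 1‖ < 1 / 100) :
    ‖fderiv ℂ fedMean U - meanCLM ι 𝔸‖ ≤ 21 * ‖U - 1‖ := by
  refine ContinuousLinearMap.opNorm_le_bound _ (by positivity) fun W => ?_
  rw [sub_apply]
  calc ‖fderiv ℂ fedMean U W - meanCLM ι 𝔸 W‖ ≤ 21 * ‖W‖ * ‖U - 1‖ := norm_fderiv_fedMean_sub_mean_le hU W
    _ = 21 * ‖U - 1‖ * ‖W‖ := by ring

/-- The derivative of `U ↦ log (fedMean U)` at a `1/100`-small family: `D log(M) ∘ D fedMean(U)` with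
`D log (M) = Σ' n, LogFDeriv.term (M − 1) n`. [folklore] -/
theorem hasFDerivAt_mlog_fedMean {U : ι → 𝔸} (hU : ∀ j, ‖U j - 1‖ < 1 / 100) :
    HasFDerivAt (fun U : ι → 𝔸 => mlog (fedMean U))
      ((∑' n, LogFDeriv.term (fedMean U - 1) n) ∘L fderiv ℂ fedMean U) U := by
  have hsup : ‖U - 1‖ < 1 / 100 := (pi_norm_lt_iff (by norm_num)).mpr fun j => hU j
  have hM : ‖fedMean U - 1‖ < 1 := (norm_fedMean_sub_one_le le_rfl hsup.le).trans_lt (by norm_num)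
  have h := (LogFDeriv.hasFDerivAt_logOnePlus_sub_one hM).comp U (hasFDerivAt_fedMean hU).differentiableAt.hasFDerivAt
  exact h

/-- **(U5) in log form with a DIRECT constant for Federbush's mean**: for `‖U − 1‖ < 1/100`,
`‖D(log ∘ fedMean)(U) W − |I|⁻¹ Σ_j W_j‖ ≤ 25 · max_j ‖W_j‖ · max_j ‖U_j − 1‖` (compare the generic
`isAnalyticMean_fedMean.norm_fderiv_mlog_sub_mean_le`: `64K/r² = 2·10⁴` on `‖U − 1‖ ≤ 1/800`).
[cite: Balaban1987RG1, (0.8) p.253] -/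
theorem norm_fderiv_mlog_fedMean_sub_mean_le {U : ι → 𝔸} (hU : ‖U - 1‖ < 1 / 100) (W : ι → 𝔸) :
    ‖fderiv ℂ (fun U : ι → 𝔸 => mlog (fedMean U)) U W - meanCLM ι 𝔸 W‖ ≤ 25 * ‖W‖ * ‖U - 1‖ := by
  set δ := ‖U - 1‖ with hδdef
  have hδ0 : 0 ≤ δ := norm_nonneg _
  have hUj : ∀ j, ‖U j - 1‖ ≤ δ := fun j => by rw [hδdef]; exact norm_le_pi_norm (U - 1) j
  have hUj' : ∀ j, ‖U j - 1‖ < 1 / 100 := fun j => (hUj j).trans_lt hU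
  rw [(hasFDerivAt_mlog_fedMean hUj').fderiv, ContinuousLinearMap.comp_apply]
  set T := ∑' n, LogFDeriv.term (fedMean U - 1) n with hT
  set w := fderiv ℂ fedMean U W with hw
  have hM : ‖fedMean U - 1‖ ≤ 31 / 10 * δ := norm_fedMean_sub_one_le hU.le le_rfl
  have hM1 : ‖fedMean U - 1‖ < 1 := by linarith
  have hT1 : ‖T - 1‖ ≤ 16 / 5 * δ := by
    have h1 := LogFDeriv.norm_tsum_term_sub_id_le hM1
    rw [← ContinuousLinearMap.one_def] at h1
    refine h1.trans ?_
    rw [div_le_iff₀ (by linarith)]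
    nlinarith [norm_nonneg (fedMean U - 1)]
  have hw1 : ‖w - meanCLM ι 𝔸 W‖ ≤ 21 * ‖W‖ * δ := norm_fderiv_fedMean_sub_mean_le hU W
  have hwn : ‖w‖ ≤ ‖W‖ + 21 * ‖W‖ * δ := by
    have : w = meanCLM ι 𝔸 W + (w - meanCLM ι 𝔸 W) := by abel
    rw [this]
    exact (norm_add_le _ _).trans (add_le_add (B7TransferAnalyticMean.norm_meanCLM_apply_le W) hw1)
  have hsplit : T w - meanCLM ι 𝔸 W = (T - 1) w + (w - meanCLM ι 𝔸 W) := by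
    rw [sub_apply, one_apply_eq_self]; abel
  rw [hsplit]
  calc ‖(T - 1) w + (w - meanCLM ι 𝔸 W)‖ ≤ ‖T - 1‖ * ‖w‖ + ‖w - meanCLM ι 𝔸 W‖ :=
        (norm_add_le _ _).trans (add_le_add (ContinuousLinearMap.le_opNorm _ _) le_rfl)
    _ ≤ 16 / 5 * δ * (‖W‖ + 21 * ‖W‖ * δ) + 21 * ‖W‖ * δ :=
        add_le_add (mul_le_mul hT1 hwn (norm_nonneg _) (by positivity)) hw1
    _ ≤ 25 * ‖W‖ * δ := by
        have h' := mul_nonneg (mul_nonneg hδ0 (norm_nonneg W)) (sub_nonneg.mpr hU.le)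
        nlinarith [h', mul_nonneg hδ0 (norm_nonneg W)]

end Deriv

/-! ## A6. Sanity and non-vacuity at literal types (v2.2, append-only): Federbush's mean of commuting scalars is the
geometric mean; the headline statements at `Fin 2 → Matrix (Fin 2) (Fin 2) ℂ` -/

section Scalars

variable {ι : Type*} [Fintype ι] [Nonempty ι]

/-- **FEDERBUSH'S MEAN OF COMMUTING SCALARS IS THE GEOMETRIC MEAN** (sanity / non-vacuity with content): for `𝔸 = ℂ`
and `|u_j − 1| ≤ 1/100`, `(fedMean u)^{|I|} = Π_j u_j` — exponentiate (0.10): `Π_j (u_j X) = exp (Σ_j log (u_j X)) = 1`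
with `X = fedSol u = (fedMean u)⁻¹`. [folklore] -/
theorem fedMean_pow_card_eq_prod {u : ι → ℂ} (hu : ∀ j, ‖u j - 1‖ ≤ 1 / 100) :
    fedMean u ^ Fintype.card ι = ∏ j, u j := by
  set X : ℂ := fedSol u with hXdef
  have hX : ‖X - 1‖ ≤ 3 * (1 / 100) := norm_fedSol_sub_one_le le_rfl hu
  have hsmall : ∀ j, ‖u j * X - 1‖ < 1 := fun j => by
    have h := norm_mul_sub_one_le (hu j) hX
    linarith
  have hprod : ∏ j, (u j * X) = 1 := by
    calc ∏ j, (u j * X) = ∏ j, exp (mlog (u j * X)) := by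
          refine Finset.prod_congr rfl fun j _ => ?_
          rw [exp_mlog (hsmall j)]
      _ = exp (∑ j, mlog (u j * X)) := (exp_sum _ _).symm
      _ = 1 := by rw [sum_mlog_mul_fedSol hu, exp_zero]
  rw [Finset.prod_mul_distrib, Finset.prod_const, Finset.card_univ] at hprod
  have hXM : X * fedMean u = 1 := fedSol_mul_fedMean u
  calc fedMean u ^ Fintype.card ι = (∏ j, u j) * X ^ Fintype.card ι * fedMean u ^ Fintype.card ι := by
        rw [hprod, one_mul]
    _ = (∏ j, u j) * (X * fedMean u) ^ Fintype.card ι := by rw [mul_pow]; ring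
    _ = ∏ j, u j := by rw [hXM, one_pow, mul_one]

/-- Two commuting scalars: `(fedMean u)² = u₀ u₁`. [folklore] -/
theorem fedMean_sq_eq_mul {u : Fin 2 → ℂ} (hu : ∀ j, ‖u j - 1‖ ≤ 1 / 100) : fedMean u ^ 2 = u 0 * u 1 := by
  have h := fedMean_pow_card_eq_prod hu
  rwa [Fintype.card_fin, Fin.prod_univ_two] at h

/-- A concrete non-identity family: `u = (201/200, 199/200)`, `(fedMean u)² = 39999/40000`. [folklore] -/
theorem fedMean_sq_example : fedMean ![(201 : ℂ) / 200, 199 / 200] ^ 2 = 39999 / 40000 := by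
  have hu : ∀ j : Fin 2, ‖(![(201 : ℂ) / 200, 199 / 200]) j - 1‖ ≤ 1 / 100 := by
    refine Fin.forall_fin_two.mpr ⟨?_, ?_⟩
    · have : (![(201 : ℂ) / 200, 199 / 200]) 0 - 1 = ((1 / 200 : ℝ) : ℂ) := by
        simp only [Matrix.cons_val_zero]; push_cast; ring
      rw [this, Complex.norm_real]; norm_num
    · have : (![(201 : ℂ) / 200, 199 / 200]) 1 - 1 = ((-(1 / 200) : ℝ) : ℂ) := by
        simp only [Matrix.cons_val_one]; push_cast; ring
      rw [this, Complex.norm_real]; norm_num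
  rw [fedMean_sq_eq_mul hu]
  simp; ring

end Scalars

section MatrixInstances

open scoped Matrix.Norms.L2Operator
open B7TransferAnalyticMean (meanCLM IsAnalyticMean)

/-- Non-vacuity at literal types (two blocks, `2 × 2` complex matrices, `L²`-operator norm): the (0.8) discharge
`isAnalyticMean_fedMean` specialises. [folklore] -/
theorem isAnalyticMean_fedMean_matrixTwo :
    IsAnalyticMean (fedMean : (Fin 2 → Matrix (Fin 2) (Fin 2) ℂ) → Matrix (Fin 2) (Fin 2) ℂ) (1 / 100) (1 / 32) :=
  isAnalyticMean_fedMean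

/-- Non-vacuity at literal types of the (0.8″) derivative form with direct constant `21`. [folklore] -/
theorem norm_fderiv_fedMean_sub_mean_le_matrixTwo (U W : Fin 2 → Matrix (Fin 2) (Fin 2) ℂ) (hU : ‖U - 1‖ < 1 / 100) :
    ‖fderiv ℂ fedMean U W - meanCLM (Fin 2) (Matrix (Fin 2) (Fin 2) ℂ) W‖ ≤ 21 * ‖W‖ * ‖U - 1‖ :=
  norm_fderiv_fedMean_sub_mean_le hU W

/-- Non-vacuity at literal types of the (0.8″) derivative LOG form with direct constant `25`. [folklore] -/
theorem norm_fderiv_mlog_fedMean_sub_mean_le_matrixTwo (U W : Fin 2 → Matrix (Fin 2) (Fin 2) ℂ)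
    (hU : ‖U - 1‖ < 1 / 100) :
    ‖fderiv ℂ (fun U : Fin 2 → Matrix (Fin 2) (Fin 2) ℂ => mlog (fedMean U)) U W
        - meanCLM (Fin 2) (Matrix (Fin 2) (Fin 2) ℂ) W‖ ≤ 25 * ‖W‖ * ‖U - 1‖ :=
  norm_fderiv_mlog_fedMean_sub_mean_le hU W

end MatrixInstances

end FederbushMean

end Literature.MathematicalPhysics.QuantumFieldTheory.Balaban1983to89
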